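import Literature.NumberTheory.EllipticCurves.NewformGaloisRep
import Literature.NumberTheory.EllipticCurves.HeckeIntegrality
import Literature.NumberTheory.EllipticCurves.HeckeOperatorsDiamondCommProofs
import Literature.NumberTheory.EllipticCurves.ModularCurveSturmProofs
import Literature.NumberTheory.Automorphic.LanglandsTunnellLSeriesProofs
import HarnessLib

/-!
# Integrality of the Hecke polynomial of a newform on `Γ₁(N)`:
# decomposition of `IsNewform1.exists_map_eq_heckePolynomial` (Deligne–Serre 1974, Prop. 2.7)

D-0014 keeps `Literature/` sorry-free by stating cited results as named facts `def X : Prop`.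
The named fact `Literature.NumberTheory.EllipticCurves.ModularForms.IsNewform1.exists_map_eq_heckePolynomial` of
`Literature.NumberTheory.EllipticCurves.NewformGaloisRep` says: for a newform
`f = ∑ aₙ qⁿ ∈ S_k(Γ₁(N))` (`IsNewform1 f`), `k ≥ 1`, and every `q : ℕ`, the Hecke polynomial
`X² − a_q X + ε(q) q^{k−1} ∈ K_f[X]` (`heckePolynomial f q`, `ε = nebentypus f`) lifts to
`𝓞_f[X]` (`coeffCharIntegers f = integralClosure ℤ K_f`), i.e. `a_q` and `ε(q) q^{k−1}` are
algebraic integers.  Its one dependent (`DeligneSerre1974.thm41_exists_of`,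
`Literature.NumberTheory.EllipticCurves.DeligneSerreWeightOneProofs`) uses it in weight `k = 1`.

**Sources.**  The bracket cite of the fact, Shimura 1971, Thm. 3.48, covers `k ≥ 2` only
("Suppose that `k ≥ 2`. … (3) The characteristic polynomial of `[X]_k` for every `X ∈ 𝔅` has
rational integral coefficients"; its Hecke-stable lattice (3.5.20) comes from the
Eichler–Shimura isomorphism, §8.4), and Diamond–Shurman Thm. 6.5.1 is weight `2`.  The source
covering every weight `k ≥ 1` — and the one Deligne–Serre themselves invoke in weight one (§8.2:
"D'après 2.7, les `a_p` et les `ε(p)` appartiennent à l'anneau des entiers `𝓞_K` d'un corps de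
nombres `K`") — is Deligne–Serre 1974, **Prop. 2.7** (p. 512): *Soit `L` l'ensemble des `f ∈ S_ℂ`
telles que `(f|R_d)_∞(q) ∈ ℤ[[q]]` pour tout `d ∈ (ℤ/Nℤ)^*`.  Alors : (2.7.1) `L` est un
`ℤ`-module libre de type fini, stable par les opérateurs `T_p` et `R_d`.  (2.7.2) Pour tout corps
`K` de caractéristique `0`, on a `S_K = K ⊗ L`.  (2.7.3) Les valeurs propres des `T_p` dans `S_ℂ`
sont des entiers d'une extension finie de `ℚ`.*  Of these, only the spanning statement (2.7.2)
is deep (it rests on (2.6.1) `S_K = K ⊗ S_ℚ`, the modular stack of Deligne–Rapoport, and on the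
boundedness of denominators from the Tate curve, Rem. 2.8); everything else is proved here.

## Contents (namespace `Literature.ModularForms`)

* `cuspCoeffₗ hΓ n` — the `n`-th Fourier coefficient as a `ℂ`-linear functional on `S_k(Γ)`.
* `integralLattice1 N k` — Deligne–Serre's `L ⊆ S_k(Γ₁(N))`: the cusp forms `f` such that
  `⟨d⟩ f` has integer Fourier coefficients for every `d ∈ (ℤ/Nℤ)ˣ` (a `ℤ`-submodule);
  `mem_integralLattice1`.
* `DeligneSerre1974_span_integralLattice1 N k` — **the named fact (2.7.2)** (the only unproved
  input): for `k ≥ 1`, `L` spans `S_k(Γ₁(N))` over `ℂ`.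
* **Proved, (2.7.1):** `integralLattice1_fg` (`L` is finitely generated — by the cuspidal Sturm
  bound `cuspForm_eq_zero_of_qExpansion_coeff_eq_zero` finitely many coefficients embed `L` into
  `ℤ^M`; this is Deligne–Serre's "les formes linéaires « n-ièmes coefficients » séparent les
  éléments de `S_ℂ`"), `diamondOp_mem_integralLattice1` and `heckeT_mem_integralLattice1` (`L` is
  stable under `⟨d⟩` and under `T_p` for *every* prime `p`, `U_p` included, from the proved
  `q`-expansion formula `qExpansion_coeff_heckeT_gamma1_holds` (Diamond–Shurman (5.3); Deligne–Serre
  (2.5.1)), `heckeT_diamondOp_comm_holds` and `diamondOp_mul_holds`; `k ≥ 1` makes `p^{k−1} ∈ ℤ`).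
* **Proved, (2.7.3) in operator form:** `heckeT_gamma1_isIntegral`, `diamondOp_isIntegral` — given
  (2.7.2), `T_p` (all primes `p`) and `⟨d⟩` are integral over `ℤ` in `End_ℂ(S_k(Γ₁(N)))` (the lattice
  argument `isIntegral_of_mapsTo_lattice` of `HeckeIntegrality`), hence
  `isIntegral_of_heckeT_gamma1_apply_eq_smul`: Hecke eigenvalues on `S_k(Γ₁(N))`, `k ≥ 1`, are
  algebraic integers.
* **Proved, §8.2 for newforms:** `IsNewform1.isIntegral_cuspCoeff` — all Fourier coefficients of
  a newform on `Γ₁(N)` are algebraic integers (`a_p` is the `T_p`-eigenvalue by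
  `IsNewform1.heckeEigenvalue_eq_coeff_holds`; prime powers and coprime products by the proved
  Hecke relations `IsNewform1.cuspCoeff_prime_pow_add_two_holds`,
  `IsNewform1.cuspCoeff_mul_of_coprime_holds`; `a₀ = 0`, `a₁ = 1`);
  `isIntegral_dirichletCharacter_apply`, `isIntegral_nebentypus_mul_zpow` — `ε(q) q^{k−1}` is an
  algebraic integer (character values are roots of unity or `0`).
* **Assembly:** `IsNewform1.exists_map_eq_heckePolynomial_of_span_integralLattice1` — the fact
  `IsNewform1.exists_map_eq_heckePolynomial` follows from `DeligneSerre1974_span_integralLattice1 N k`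
  alone.  Once (2.7.2) is discharged, `exists_map_eq_heckePolynomial_holds` is this theorem applied
  to its `_holds`.

## Design notes

* The lattice is Deligne–Serre's own (`q`-integrality of all diamond twists), not Shimura's
  cohomological lattice (3.5.20) (`Shimura1971_heckeStableLattice` of `HeckeIntegrality`, level
  `Γ₀(N)`, `k ≥ 2`): it is explicit, its finiteness and Hecke-stability are provable in the tree,
  and it is the lattice that covers weight one.  For `k ≥ 2` Shimura's Thm. 3.48 (3) gives the same
  operator integrality independently.
* (2.7.2) is recorded in the form used downstream, `span_ℂ L = S_k(Γ₁(N))` (surjectivity of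
  `ℂ ⊗_ℤ L → S_ℂ`); the printed `S_K = K ⊗ L` also asserts injectivity (a `ℤ`-basis of `L` is
  `ℂ`-free), so the named fact is implied by, and formally slightly weaker than, (2.7.2).
  Deligne–Serre's `R_d` is the diamond operator; as `L` quantifies over all units `d`, the
  normalisation `⟨d⟩` versus `⟨d⟩⁻¹` is immaterial.  Their `f_∞(q)` is the expansion in
  `q = e^{2πiz}` ((2.4.2)), Mathlib's `qExpansion 1`.
* Nothing here weakens `IsNewform1.exists_map_eq_heckePolynomial` (all `q : ℕ`, all `k ≥ 1`).

## References

* P. Deligne, J.-P. Serre, *Formes modulaires de poids 1*, Ann. Sci. ÉNS (4) 7 (1974), 507–530,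
  doi:10.24033/asens.1277 — §2.5 (2.5.1), §2.6 (2.6.1), Prop. 2.7, Rem. 2.8, §8.2.
* G. Shimura, *Introduction to the arithmetic theory of automorphic functions*, Publ. Math. Soc.
  Japan 11 (1971) — Thm. 3.48, (3.5.20), Thm. 3.52.
* F. Diamond, J. Shurman, *A first course in modular forms*, GTM 228 (2005) — Prop. 5.2.2 / (5.3),
  Prop. 5.8.5, Thm. 6.5.1.
-/

noncomputable section

open scoped MatrixGroups ModularForm NumberField

open CongruenceSubgroup UpperHalfPlane Polynomial

namespace Literature.NumberTheory.EllipticCurves.ModularForms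

/-! ### Fourier coefficients as linear functionals -/

section Functional

variable {Γ : Subgroup (GL (Fin 2) ℝ)} [Γ.HasDetOne] {k : ℤ}

/-- The `n`-th Fourier coefficient `f ↦ aₙ(f)` (`cuspCoeff f n`, period-`1` expansion) as a
`ℂ`-linear functional on `S_k(Γ)`, for a level `Γ ∋ T` (`1 ∈ Γ.strictPeriods`, e.g. `Γ₀(N)`,
`Γ₁(N)`); linearity is Mathlib's `qExpansion_add` / `qExpansion_smul` (Deligne–Serre 1974, proof of
Prop. 2.7: "les formes linéaires « n-ièmes coefficients »"). [folklore] -/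
def cuspCoeffₗ (hΓ : (1 : ℝ) ∈ Γ.strictPeriods) (n : ℕ) : CuspForm Γ k →ₗ[ℂ] ℂ where
  toFun f := cuspCoeff f n
  map_add' f g := by
    change (qExpansion 1 ⇑(f + g)).coeff n = (qExpansion 1 ⇑f).coeff n + (qExpansion 1 ⇑g).coeff n
    rw [CuspForm.coe_add, qExpansion_add (ModularFormClass.analyticAt_cuspFunction_zero f one_pos hΓ)
      (ModularFormClass.analyticAt_cuspFunction_zero g one_pos hΓ), map_add]
  map_smul' c f := by
    change (qExpansion 1 ⇑(c • f)).coeff n = c * (qExpansion 1 ⇑f).coeff n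
    rw [CuspForm.IsGLPos.coe_smul,
      qExpansion_smul (ModularFormClass.analyticAt_cuspFunction_zero f one_pos hΓ), map_smul,
      smul_eq_mul]

/-- Unfolding lemma for `cuspCoeffₗ`. [folklore] -/
@[simp] lemma cuspCoeffₗ_apply (hΓ : (1 : ℝ) ∈ Γ.strictPeriods) (n : ℕ) (f : CuspForm Γ k) :
    cuspCoeffₗ hΓ n f = cuspCoeff f n :=
  rfl

end Functional

/-! ### Deligne–Serre's lattice `L ⊆ S_k(Γ₁(N))` and Prop. 2.7 -/

section Lattice

variable (N : ℕ) [NeZero N] (k : ℤ)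

/-- **Deligne–Serre's `ℤ`-module `L`** (Deligne–Serre 1974, Prop. 2.7): the cusp forms
`f ∈ S_k(Γ₁(N))` such that for every `d ∈ (ℤ/Nℤ)ˣ` the diamond twist `⟨d⟩ f = f|R_d` has all its
Fourier coefficients in `ℤ` ("`(f|R_d)_∞(q) ∈ ℤ[[q]]` pour tout `d ∈ (ℤ/Nℤ)^*`"), as a
`ℤ`-submodule of `S_k(Γ₁(N))`: the intersection over `d` and `n` of the preimages of `ℤ ⊆ ℂ` under
the `ℤ`-linear maps `f ↦ aₙ(⟨d⟩ f)`. [cite: DeligneSerreASENS1974, Prop. 2.7] -/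
def integralLattice1 : Submodule ℤ (CuspForm (Gamma1 N) k) :=
  ⨅ d : (ZMod N)ˣ, ⨅ n : ℕ,
    (LinearMap.range (Algebra.linearMap ℤ ℂ)).comap
      ((cuspCoeffₗ (HeckeTGamma1.one_mem_strictPeriods_Gamma1 N) n ∘ₗ
        diamondOp N k (d : ZMod N)).restrictScalars ℤ)

variable {N k}

/-- Membership in Deligne–Serre's lattice: `f ∈ L` iff `aₙ(⟨d⟩ f) ∈ ℤ` for all units `d` and all
`n` (unfolding lemma). [cite: DeligneSerreASENS1974, Prop. 2.7] -/
lemma mem_integralLattice1 {f : CuspForm (Gamma1 N) k} :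
    f ∈ integralLattice1 N k ↔
      ∀ (d : (ZMod N)ˣ) (n : ℕ), ∃ z : ℤ, (z : ℂ) = cuspCoeff (diamondOp N k (d : ZMod N) f) n := by
  simp [integralLattice1, Submodule.mem_iInf, LinearMap.mem_range]

/-- An element of `L` has integer Fourier coefficients (`d = 1`, `⟨1⟩ = id`). [folklore] -/
lemma exists_int_eq_cuspCoeff_of_mem_integralLattice1 {f : CuspForm (Gamma1 N) k}
    (hf : f ∈ integralLattice1 N k) (n : ℕ) : ∃ z : ℤ, (z : ℂ) = cuspCoeff f n := by
  simpa [Automorphic.ModularForms.diamondOp_one_apply] using mem_integralLattice1.mp hf 1 n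

variable (N k) in
/-- **Deligne–Serre 1974, (2.7.1), finiteness: `L` is a finitely generated `ℤ`-module** (hence
free, being torsion-free).  Proof as printed ("Que `L` soit de type fini provient de ce que les
formes linéaires « n-ièmes coefficients des `(f|R_d)_∞(q)` » séparent les éléments de `S_ℂ`"): by
the cuspidal Sturm bound (`cuspForm_eq_zero_of_qExpansion_coeff_eq_zero`) the coefficients
`a_0, …, a_{M-1}` already separate `S_k(Γ₁(N))`, and on `L` they are integers, so `L` embeds into
`ℤ^M`, a Noetherian `ℤ`-module. [cite: DeligneSerreASENS1974, Prop. 2.7 (2.7.1)] -/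
theorem integralLattice1_fg : (integralLattice1 N k).FG := by
  classical
  set M : ℕ := ((k * Nat.card (𝒮ℒ ⧸ (Gamma1 N : Subgroup (GL (Fin 2) ℝ)).subgroupOf 𝒮ℒ)).toNat / 12
    : ℕ) + 2 with hM
  -- the truncated `q`-expansion `f ↦ (a_0(f), …, a_{M-1}(f))`, injective by the Sturm bound
  let Φ : CuspForm (Gamma1 N) k →ₗ[ℂ] (Fin M → ℂ) :=
    LinearMap.pi fun j ↦ cuspCoeffₗ (HeckeTGamma1.one_mem_strictPeriods_Gamma1 N) (j : ℕ)
  have hΦ : Function.Injective Φ := by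
    rw [injective_iff_map_eq_zero]
    intro f hf
    refine cuspForm_eq_zero_of_qExpansion_coeff_eq_zero
      (HeckeTGamma1.one_mem_strictPeriods_Gamma1 N) f (m := M) (fun i hi ↦ ?_) (by omega)
    exact congr_fun hf ⟨i, hi⟩
  -- `Φ(L) ⊆ ℤ^M`
  let T : (Fin M → ℤ) →ₗ[ℤ] (Fin M → ℂ) := (Algebra.linearMap ℤ ℂ).compLeft (Fin M)
  have hle : (integralLattice1 N k).map (Φ.restrictScalars ℤ) ≤ LinearMap.range T := by
    rintro _ ⟨f, hf, rfl⟩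
    choose z hz using exists_int_eq_cuspCoeff_of_mem_integralLattice1 hf
    refine ⟨fun j ↦ z j, ?_⟩
    funext j
    simp [T, Φ, hz]
  have hfgT : ((integralLattice1 N k).map (Φ.restrictScalars ℤ)).FG := by
    rw [← Submodule.map_comap_eq_self hle]
    exact (IsNoetherian.noetherian _).map T
  exact Submodule.fg_of_fg_map_injective (Φ.restrictScalars ℤ) (fun a b h ↦ hΦ h) hfgT

/-- **Deligne–Serre 1974, (2.7.1), stability under `R_d`:** `L` is stable under every diamond
operator `⟨e⟩`, `e ∈ (ℤ/Nℤ)ˣ` ("évident": `⟨d⟩ ⟨e⟩ f = ⟨d e⟩ f`, `diamondOp_mul_holds`). [cite: DeligneSerreASENS1974, Prop. 2.7 (2.7.1)] -/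
theorem diamondOp_mem_integralLattice1 {f : CuspForm (Gamma1 N) k}
    (hf : f ∈ integralLattice1 N k) (e : (ZMod N)ˣ) :
    diamondOp N k (e : ZMod N) f ∈ integralLattice1 N k := by
  rw [mem_integralLattice1] at hf ⊢
  intro d n
  obtain ⟨z, hz⟩ := hf (d * e) n
  refine ⟨z, ?_⟩
  rw [hz, Units.val_mul, diamondOp_mul_holds N k d.isUnit e.isUnit, Module.End.mul_apply]

/-- **Deligne–Serre 1974, (2.7.1), stability under `T_p`:** for `k ≥ 1`, `L` is stable under
`T_p = heckeT (Gamma1 N) k p` for every prime `p` — including `U_p` for `p ∣ N`, by the same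
one-line argument ("résulte de (2.5.1)"): `aₙ(⟨d⟩ T_p f) = aₙ(T_p ⟨d⟩ f)`
(`heckeT_diamondOp_comm_holds`) `= a_{pn}(⟨d⟩ f) + 𝟙_N(p) p^{k-1} a_{n/p}(⟨p⟩ ⟨d⟩ f)`
(`qExpansion_coeff_heckeT_gamma1_holds`, Diamond–Shurman (5.3) / Deligne–Serre (2.5.1)), and
`⟨p⟩ ⟨d⟩ = ⟨p d⟩` for `p ∤ N` (`diamondOp_mul_holds`), `p^{k-1} ∈ ℤ` as `k ≥ 1`. [cite: DeligneSerreASENS1974, Prop. 2.7 (2.7.1) with (2.5.1)] -/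
theorem heckeT_mem_integralLattice1 (hk : 1 ≤ k) {f : CuspForm (Gamma1 N) k}
    (hf : f ∈ integralLattice1 N k) (p : ℕ) [NeZero p] (hp : p.Prime) :
    heckeT (Gamma1 N) k p f ∈ integralLattice1 N k := by
  rw [mem_integralLattice1] at hf ⊢
  intro d n
  have hcomm : diamondOp N k (d : ZMod N) (heckeT (Gamma1 N) k p f) =
      heckeT (Gamma1 N) k p (diamondOp N k (d : ZMod N) f) := by
    rw [← Module.End.mul_apply, ← heckeT_diamondOp_comm_holds N k p (d : ZMod N),
      Module.End.mul_apply]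
  have hq := qExpansion_coeff_heckeT_gamma1_holds N k (diamondOp N k (d : ZMod N) f) p hp n
  change ∃ z : ℤ,
    (z : ℂ) = (qExpansion 1 ⇑(diamondOp N k (d : ZMod N) (heckeT (Gamma1 N) k p f))).coeff n
  rw [hcomm, hq]
  obtain ⟨z₁, hz₁⟩ := hf d (p * n)
  obtain ⟨m, hm⟩ : ∃ m : ℕ, k - 1 = m := ⟨(k - 1).toNat, (Int.toNat_of_nonneg (by omega)).symm⟩
  by_cases hpN : p ∣ N
  · exact ⟨z₁, by rw [if_pos hpN, add_zero]; exact hz₁⟩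
  · rw [if_neg hpN]
    by_cases hpn : p ∣ n
    · obtain ⟨u, hu⟩ := ZMod.isUnit_prime_of_not_dvd hp hpN
      obtain ⟨z₂, hz₂⟩ := hf (u * d) (n / p)
      refine ⟨z₁ + p ^ m * z₂, ?_⟩
      rw [if_pos hpn, hm, zpow_natCast, ← hu, ← Module.End.mul_apply,
        ← diamondOp_mul_holds N k u.isUnit d.isUnit, ← Units.val_mul]
      push_cast
      rw [hz₁, hz₂]
      rfl
    · exact ⟨z₁, by rw [if_neg hpn, mul_zero, add_zero]; exact hz₁⟩

variable (N k) in
/-- **Deligne–Serre 1974, Prop. 2.7, (2.7.2)** (named fact; the deep input).  *"Pour tout corps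
`K` de caractéristique `0`, on a `S_K = K ⊗ L`"*, where `S_K` is the space of cusp forms of weight
`k` on `Γ₁(N)` defined over `K` (§2.6; for `K = ℂ` the classical `S_k(Γ₁(N))` with its
`q`-expansions at `∞`, §2.4–2.5) and `L ⊆ S_ℂ` is the `ℤ`-module of forms all of whose twists
`f|R_d`, `d ∈ (ℤ/Nℤ)^*`, have `q`-expansion in `ℤ[[q]]` (`integralLattice1 N k`).  **Recorded
form:** for `K = ℂ` and `k ≥ 1` (the weights of the paper; `N ≥ 1`), the surjectivity half of
`ℂ ⊗_ℤ L ≅ S_ℂ`: *`L` spans `S_k(Γ₁(N))` over `ℂ`*.  The printed statement also contains the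
injectivity (a `ℤ`-basis of `L` stays `ℂ`-free) and (2.7.1) (finite type — proved here,
`integralLattice1_fg` — and Hecke stability — proved here); so this `Prop` is implied by, and
formally weaker than, Prop. 2.7.  Printed proof: (2.6.1) `S_K = K ⊗_ℚ S_ℚ` (the space of sections
of an invertible sheaf on the modular stack of `Γ₁(N)`, [7] = Deligne–Rapoport, VII 3.2) and
bounded denominators of `f_∞(q)` for `f ∈ S_ℚ` (the Tate curve is defined over `ℤ((q)) ⊗ ℚ`;
Rem. 2.8: alternatively Shimura 1971, Thm. 3.52 for `k ≥ 2` and multiplication by `Δ` to pass from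
weight `1` to weight `13`).  Mathlib has neither modular curves nor any rational structure on
`CuspForm Γ k`. [cite: DeligneSerreASENS1974, Prop. 2.7 (2.7.2)] -/
def DeligneSerre1974_span_integralLattice1 : Prop :=
  1 ≤ k → Submodule.span ℂ (integralLattice1 N k : Set (CuspForm (Gamma1 N) k)) = ⊤

/-- **Deligne–Serre 1974, (2.7.3), operator form: `T_p` is integral over `ℤ` on `S_k(Γ₁(N))`**
for `k ≥ 1` and every prime `p` (`U_p` for `p ∣ N` included), granted (2.7.2): `T_p` maps the
finitely generated spanning lattice `L` into itself (`integralLattice1_fg`,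
`heckeT_mem_integralLattice1`), so it satisfies the monic integer polynomial furnished by
Cayley–Hamilton on `L` (`isIntegral_of_mapsTo_lattice`).  For `k ≥ 2` this is also
Shimura 1971, Thm. 3.48 (3) (`Γ' = Γ₁(N)` is of type (3.3.2)). [cite: DeligneSerreASENS1974, Prop. 2.7 (2.7.3) and its proof] -/
theorem heckeT_gamma1_isIntegral (hL : DeligneSerre1974_span_integralLattice1 N k) (hk : 1 ≤ k)
    (p : ℕ) [NeZero p] (hp : p.Prime) : IsIntegral ℤ (heckeT (Gamma1 N) k p) :=
  isIntegral_of_mapsTo_lattice (integralLattice1_fg N k) (hL hk) fun _ hf ↦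
    heckeT_mem_integralLattice1 hk hf p hp

/-- The diamond operators `⟨d⟩`, `d ∈ (ℤ/Nℤ)ˣ`, are integral over `ℤ` on `S_k(Γ₁(N))`, `k ≥ 1`,
granted (2.7.2) (same lattice argument with `diamondOp_mem_integralLattice1`; of course also
because `⟨d⟩^{φ(N)} = 1`). [cite: DeligneSerreASENS1974, Prop. 2.7 (2.7.1)–(2.7.2)] -/
theorem diamondOp_isIntegral (hL : DeligneSerre1974_span_integralLattice1 N k) (hk : 1 ≤ k)
    (d : (ZMod N)ˣ) : IsIntegral ℤ (diamondOp N k (d : ZMod N)) :=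
  isIntegral_of_mapsTo_lattice (integralLattice1_fg N k) (hL hk) fun _ hf ↦
    diamondOp_mem_integralLattice1 hf d

/-- **Deligne–Serre 1974, (2.7.3): Hecke eigenvalues on `S_k(Γ₁(N))` are algebraic integers**
(`k ≥ 1`, every prime `p`), granted (2.7.2): if `0 ≠ f ∈ S_k(Γ₁(N))` and `T_p f = a f` then `a`
is a root of the monic integer polynomial annihilating `T_p` (`isIntegral_eigenvalue`). [cite: DeligneSerreASENS1974, Prop. 2.7 (2.7.3)] -/
theorem isIntegral_of_heckeT_gamma1_apply_eq_smul (hL : DeligneSerre1974_span_integralLattice1 N k)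
    (hk : 1 ≤ k) {p : ℕ} [NeZero p] (hp : p.Prime) {f : CuspForm (Gamma1 N) k} (hf : f ≠ 0)
    {a : ℂ} (h : heckeT (Gamma1 N) k p f = a • f) : IsIntegral ℤ a :=
  isIntegral_eigenvalue (heckeT_gamma1_isIntegral hL hk p hp) hf h

end Lattice

/-! ### Newforms: integrality of the Fourier coefficients and of the Hecke polynomial -/

section Newforms

variable {N : ℕ} [NeZero N] {k : ℤ}

/-- The values of a Dirichlet character (with values in any commutative ring) are integral over
`ℤ`: at a unit `u` one has `χ(u)^{#(ℤ/nℤ)ˣ} = χ(u^{#(ℤ/nℤ)ˣ}) = 1`, and at a non-unit `χ = 0`. [folklore] -/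
theorem isIntegral_dirichletCharacter_apply {R : Type*} [CommRing R] {n : ℕ} [NeZero n]
    (χ : DirichletCharacter R n) (a : ZMod n) : IsIntegral ℤ (χ a) := by
  by_cases ha : IsUnit a
  · obtain ⟨u, rfl⟩ := ha
    refine IsIntegral.of_pow (Fintype.card_pos (α := (ZMod n)ˣ)) ?_
    rw [← MulChar.pow_apply_coe, MulChar.pow_card_eq_one, MulChar.one_apply_coe]
    exact isIntegral_one
  · rw [MulChar.map_nonunit χ ha]
    exact isIntegral_zero

/-- The constant term `ε(q) q^{k-1}` of the Hecke polynomial of `f ∈ S_k(Γ₁(N))`, `k ≥ 1`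
(`ε = nebentypus f`), is an algebraic integer (Deligne–Serre 1974, §8.2: "les `ε(p)`
appartiennent à l'anneau des entiers"). [folklore] -/
theorem isIntegral_nebentypus_mul_zpow (f : CuspForm (Gamma1 N) k) (hk : 1 ≤ k) (q : ℕ) :
    IsIntegral ℤ ((nebentypus f (q : ZMod N) : ℂ) * (q : ℂ) ^ (k - 1)) := by
  obtain ⟨m, hm⟩ : ∃ m : ℕ, k - 1 = m := ⟨(k - 1).toNat, (Int.toNat_of_nonneg (by omega)).symm⟩
  rw [hm, zpow_natCast]
  exact (isIntegral_dirichletCharacter_apply _ _).mul ((isIntegral_natCast q).pow m)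

/-- For a newform `f ∈ S_k(Γ₁(N))`, `k ≥ 1`, and a prime `p`, the coefficient `a_p(f)` is an
algebraic integer, granted (2.7.2): `T_p f = a_p f` (`IsNewform1.heckeEigenvalue_eq_coeff_holds`,
Diamond–Shurman Prop. 5.8.5) and `f ≠ 0`, so (2.7.3) applies (Deligne–Serre 1974, §8.2: "D'après
2.7, les `a_p` … appartiennent à l'anneau des entiers `𝓞_K`"). [cite: DeligneSerreASENS1974, §8.2] -/
theorem IsNewform1.isIntegral_cuspCoeff_prime (hL : DeligneSerre1974_span_integralLattice1 N k)
    (hk : 1 ≤ k) {f : CuspForm (Gamma1 N) k} (hf : IsNewform1 f) {p : ℕ} (hp : p.Prime) :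
    IsIntegral ℤ (cuspCoeff f p) := by
  haveI : NeZero p := ⟨hp.ne_zero⟩
  have heig := heckeT_eq_heckeEigenvalue_smul f p (hf.2.1 p hp)
  rw [IsNewform1.heckeEigenvalue_eq_coeff_holds hf hp] at heig
  exact isIntegral_of_heckeT_gamma1_apply_eq_smul hL hk hp hf.ne_zero heig

/-- For a newform `f ∈ S_k(Γ₁(N))`, `k ≥ 1`, the coefficients `a_{p^r}(f)` (`p` prime) are
algebraic integers, granted (2.7.2): two-step induction on `r` with the Hecke recursion
`a_{p^{r+2}} = a_p a_{p^{r+1}} − ε(p) p^{k−1} a_{p^r}` (`IsNewform1.cuspCoeff_prime_pow_add_two_holds`,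
Diamond–Shurman Prop. 5.8.5 (2)), `a_1 = 1`, and the integrality of `a_p` and `ε(p) p^{k−1}`. [cite: DiamondShurman2005, Prop. 5.8.5 (2)] -/
theorem IsNewform1.isIntegral_cuspCoeff_prime_pow (hL : DeligneSerre1974_span_integralLattice1 N k)
    (hk : 1 ≤ k) {f : CuspForm (Gamma1 N) k} (hf : IsNewform1 f) {p : ℕ} (hp : p.Prime) (r : ℕ) :
    IsIntegral ℤ (cuspCoeff f (p ^ r)) := by
  have hε := isIntegral_nebentypus_mul_zpow f hk p
  have hp1 := hf.isIntegral_cuspCoeff_prime hL hk hp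
  have key : ∀ r : ℕ,
      IsIntegral ℤ (cuspCoeff f (p ^ r)) ∧ IsIntegral ℤ (cuspCoeff f (p ^ (r + 1))) := by
    intro r
    induction r with
    | zero =>
      refine ⟨?_, by simpa using hp1⟩
      rw [pow_zero, show cuspCoeff f 1 = 1 from hf.2.2.2]
      exact isIntegral_one
    | succ r ih =>
      refine ⟨ih.2, ?_⟩
      rw [show r + 1 + 1 = r + 2 from rfl, IsNewform1.cuspCoeff_prime_pow_add_two_holds hf hp r]
      exact (hp1.mul ih.2).sub (hε.mul ih.1)
  exact (key r).1

/-- **The Fourier coefficients of a newform on `Γ₁(N)` are algebraic integers** (`k ≥ 1`, all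
`n ≥ 0`), granted (2.7.2) (Deligne–Serre 1974, §8.2 with Prop. 2.7; Shimura 1971, Thm. 3.48 for
`k ≥ 2`; Diamond–Shurman Thm. 6.5.1 in weight `2`): induction over the factorisation of `n`
(`Nat.recOnPosPrimePosCoprime`) — `a_0 = 0` (cusp form), `a_1 = 1`, prime powers by
`isIntegral_cuspCoeff_prime_pow`, coprime products by multiplicativity
(`IsNewform1.cuspCoeff_mul_of_coprime_holds`, Diamond–Shurman Prop. 5.8.5 (3)).  The `Γ₁(N)`
companion of the named fact `IsNewform0.isIntegral_coeff` (`Newforms`). [cite: DeligneSerreASENS1974, §8.2 with Prop. 2.7] -/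
theorem IsNewform1.isIntegral_cuspCoeff (hL : DeligneSerre1974_span_integralLattice1 N k)
    (hk : 1 ≤ k) {f : CuspForm (Gamma1 N) k} (hf : IsNewform1 f) (n : ℕ) :
    IsIntegral ℤ (cuspCoeff f n) := by
  induction n using Nat.recOnPosPrimePosCoprime with
  | zero =>
    rw [show cuspCoeff f 0 = 0 from
      CuspFormClass.qExpansion_coeff_zero f one_pos (HeckeTGamma1.one_mem_strictPeriods_Gamma1 N)]
    exact isIntegral_zero
  | one =>
    rw [show cuspCoeff f 1 = 1 from hf.2.2.2]
    exact isIntegral_one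
  | prime_pow p r hp hr => exact hf.isIntegral_cuspCoeff_prime_pow hL hk hp r
  | coprime a b ha hb hab iha ihb =>
    rw [IsNewform1.cuspCoeff_mul_of_coprime_holds hf hab]
    exact iha.mul ihb

/-- An element of the coefficient field `K_f ⊆ ℂ` is integral over `ℤ` iff it is an algebraic
integer in `ℂ` (integrality is detected through the injective map `K_f → ℂ`). [folklore] -/
theorem isIntegral_coeffCharField_iff (f : CuspForm (Gamma1 N) k) {x : coeffCharField f} :
    IsIntegral ℤ x ↔ IsIntegral ℤ (x : ℂ) :=
  (isIntegral_algHom_iff (algebraMap (coeffCharField f) ℂ).toIntAlgHom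
    (algebraMap (coeffCharField f) ℂ).injective).symm

/-- **`IsNewform1.exists_map_eq_heckePolynomial` from Deligne–Serre 1974, Prop. 2.7 (2.7.2).**
For a newform `f ∈ S_k(Γ₁(N))`, `k ≥ 1`, and every `q : ℕ`, the Hecke polynomial
`X² − a_q X + ε(q) q^{k−1} ∈ K_f[X]` is the image of a polynomial in `𝓞_f[X]`,
`𝓞_f = integralClosure ℤ K_f`, namely of `X² − a_q X + ε(q) q^{k−1}` itself: `a_q` is an algebraic
integer by `IsNewform1.isIntegral_cuspCoeff` and `ε(q) q^{k−1}` by `isIntegral_nebentypus_mul_zpow`.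
The only unproved input is the spanning statement (2.7.2), `DeligneSerre1974_span_integralLattice1 N k`;
once it is discharged, `exists_map_eq_heckePolynomial_holds` is this theorem applied to its
`_holds`. [cite: DeligneSerreASENS1974, §8.2 with Prop. 2.7] -/
theorem IsNewform1.exists_map_eq_heckePolynomial_of_span_integralLattice1
    {f : CuspForm (Gamma1 N) k} (hL : DeligneSerre1974_span_integralLattice1 N k) :
    IsNewform1.exists_map_eq_heckePolynomial (f := f) := by
  intro hf hk q
  have ha : IsIntegral ℤ
      (⟨(qExpansion 1 ⇑f).coeff q, cuspCoeff_mem_coeffCharField f q⟩ : coeffCharField f) :=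
    (isIntegral_coeffCharField_iff f).mpr (hf.isIntegral_cuspCoeff hL hk q)
  have hc : IsIntegral ℤ (⟨(nebentypus f (q : ZMod N) : ℂ) * (q : ℂ) ^ (k - 1),
      nebentypus_mul_zpow_mem_coeffCharField f q⟩ : coeffCharField f) :=
    (isIntegral_coeffCharField_iff f).mpr (isIntegral_nebentypus_mul_zpow f hk q)
  refine ⟨X ^ 2 - C ⟨_, ha⟩ * X + C ⟨_, hc⟩, ?_⟩
  simp only [heckePolynomial, Polynomial.map_add, Polynomial.map_sub, Polynomial.map_mul,
    Polynomial.map_pow, Polynomial.map_X, Polynomial.map_C]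
  rfl

end Newforms

end Literature.NumberTheory.EllipticCurves.ModularForms
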